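import Mathlib
import HarnessLib
import Summits.Ventures.LatticeQCDFlow.Scaling.PerfectRelaxationMoments
import Summits.Ventures.LatticeQCDFlow.Scaling.LinearFamilyStepMGFTwoSided

/-!
# PerfectRelaxationESSCeiling — NO GRID BEATS `e^{−σ_min²/n}`: under a variance FLOOR
# `σ_min² ≤ Var_c(D)` the reweighting ESS of `n` perfectly relaxed switching steps along ANY grid
# from `c_0` to `c_n` is at most `exp(−σ_min²·Σ_k δ_k²) ≤ exp(−σ_min²(c_n − c_0)²/n)`; on the
# uniform grid the two-sided window `e^{−σ̄²/n} ≤ ÊSS_perfect ≤ e^{−σ_min²/n}`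

HONEST FRAMING: exact (Metropolis-corrected) sampling algorithms for lattice gauge theory;
figures of merit are autocorrelation/cost numbers at stated couplings and volumes; no
continuum-physics claim.

Venture `LatticeQCDFlow` (cell pub-lqcd), topic `Scaling`; FANOUT row 19 (`su2-snf`, GEN-11).
OUR WORK (a ten-line child of `Scaling/PerfectRelaxationMoments` — `ÊSS_perfect = exp(−ΣΛ_k(2))`
exactly — and `Scaling/LinearFamilyStepMGFTwoSided` — `δ²σ_min² ≤ Λ_{c,δ}(2)` under a variance
floor), nothing cited as a fact.  MODEL: the linear family `S_c = S₀ + c·D` on a finite state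
space, PERFECT relaxation between switches (every layer resamples from its target), reweighting
ESS `ÊSS` of the path (`Exactness.essFrac` of the reverse against the forward path law).

WHY.  Perfect relaxation is the `ρ = 0` endpoint of every certified ESS floor of this row (`χ²`,
entropy, hypercontractive routes) and its ESS is the "perfect part" those floors multiply by a lag
factor (`Scaling/PerfectRelaxationMoments`, reading rule P25).  GEN-10 (d4) asked for the
matching CEILING: with it, (a) the perfect part is PINNED between two explicit exponentials on the
uniform grid, and (b) the `n_step` lever has a certified necessary size — `ÊSS ≥ e^{−η}` with
perfect layers REQUIRES `n ≥ σ_min²(c_n − c_0)²/η` steps whatever the grid (`protocol.schedule`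
lever: no schedule of `n` steps does better than `e^{−σ_min²/n}` per unit span; the uniform grid is
where floor and ceiling have the same shape).

* `sq_sum_le_mul_sum_sq` — Cauchy–Schwarz `(Σ_{k<n} δ_k)² ≤ n·Σ_{k<n} δ_k²`;
* **`essFrac_path_perfect_le_exp_sum_sq`** — any grid: `ÊSS_perfect ≤ exp(−σ_min²·Σ_k (c_{k+1} − c_k)²)`;
* **`essFrac_path_perfect_le_exp_span`** — any grid, `n ≠ 0`:
  `ÊSS_perfect ≤ exp(−σ_min²·(c_n − c_0)²/n)`;
* **`essFrac_path_perfect_uniform_le`** — uniform grid `c_k = k/n`: `ÊSS_perfect ≤ exp(−σ_min²/n)`;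
* **`essFrac_path_perfect_uniform_two_sided`** — with a ceiling `Var_c(D) ≤ σ̄²` as well:
  `exp(−σ̄²/n) ≤ ÊSS_perfect ≤ exp(−σ_min²/n)`;
* `steps_ge_of_essFrac_path_perfect_ge` — the necessary step count: `e^{−η} ≤ ÊSS_perfect` on a
  grid of span `c_n − c_0` forces `σ_min²(c_n − c_0)² ≤ η·n`.

NOT CLAIMED: anything for imperfect layers (their ESS can only be SMALLER than the perfect part
times the certified lag factors' reciprocals — no ceiling is claimed here beyond `ρ = 0`); any
value of `σ_min` for a lattice defect.
-/

namespace Summit.Ventures.LatticeQCDFlow.Scaling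

open Finset
open Literature.Probability.MarkovChains (stepLaw IsStationary)
open Summit.Ventures.LatticeQCDFlow.Exactness
open Summit.Ventures.LatticeQCDFlow.Theory2

variable {X : Type*} [Fintype X] [Nonempty X]

omit [Fintype X] [Nonempty X] in
/-- Cauchy–Schwarz for a finite grid: `(Σ_{k<n} δ_k)² ≤ n·Σ_{k<n} δ_k²`. -/
theorem sq_sum_le_mul_sum_sq (n : ℕ) (δ : ℕ → ℝ) :
    (∑ k ∈ range n, δ k) ^ 2 ≤ (n : ℝ) * ∑ k ∈ range n, δ k ^ 2 := by
  have h := sum_mul_sq_le_sq_mul_sq (range n) (fun _ => (1:ℝ)) δ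
  simpa [one_mul, one_pow, sum_const, card_range] using h

/-- **ANY GRID: `ÊSS_perfect ≤ exp(−σ_min²·Σ_k δ_k²)`** under a variance floor
`σ_min² ≤ Var_c(D)` (every `c`), for the perfectly relaxed protocol along `c_0, …, c_n`. -/
theorem essFrac_path_perfect_le_exp_sum_sq (S₀ D : X → ℝ) (c : ℕ → ℝ) (n : ℕ) {σmin : ℝ}
    (hσ : ∀ c', σmin ^ 2 ≤ varD S₀ D c') :
    essFrac (revPathLaw (fun k : Fin (n + 1) => linAction S₀ D (c k))
          (fun k : Fin n => fun (_ : X) (y : X) => gibbsLaw (linAction S₀ D (c ((k : ℕ) + 1))) y))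
        (pathLaw (gibbsLaw (linAction S₀ D (c ((0 : Fin (n + 1)) : ℕ))))
          (fun k : Fin n => fun (_ : X) (y : X) => gibbsLaw (linAction S₀ D (c ((k : ℕ) + 1))) y))
      ≤ Real.exp (-(σmin ^ 2 * ∑ k ∈ range n, (c (k + 1) - c k) ^ 2)) := by
  rw [essFrac_path_perfect_eq]
  refine Real.exp_le_exp.mpr (neg_le_neg ?_)
  rw [mul_sum]
  refine sum_le_sum fun k _ => ?_
  have h := stepLogMGF_ge_of_le_varD S₀ D (c k) (c (k + 1) - c k) hσ (t := 2)
    (Or.inr (by norm_num))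
  have e : (2:ℝ) * (2 - 1) / 2 * ((c (k + 1) - c k) ^ 2 * σmin ^ 2)
      = σmin ^ 2 * (c (k + 1) - c k) ^ 2 := by ring
  linarith

/-- **ANY GRID OF `n ≠ 0` STEPS FROM `c_0` TO `c_n`: `ÊSS_perfect ≤ exp(−σ_min²·(c_n − c_0)²/n)`** —
no schedule of `n` steps beats the uniform one's ceiling shape. -/
theorem essFrac_path_perfect_le_exp_span (S₀ D : X → ℝ) (c : ℕ → ℝ) {n : ℕ} (hn : n ≠ 0)
    {σmin : ℝ} (hσ : ∀ c', σmin ^ 2 ≤ varD S₀ D c') :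
    essFrac (revPathLaw (fun k : Fin (n + 1) => linAction S₀ D (c k))
          (fun k : Fin n => fun (_ : X) (y : X) => gibbsLaw (linAction S₀ D (c ((k : ℕ) + 1))) y))
        (pathLaw (gibbsLaw (linAction S₀ D (c ((0 : Fin (n + 1)) : ℕ))))
          (fun k : Fin n => fun (_ : X) (y : X) => gibbsLaw (linAction S₀ D (c ((k : ℕ) + 1))) y))
      ≤ Real.exp (-(σmin ^ 2 * (c n - c 0) ^ 2 / n)) := by
  refine (essFrac_path_perfect_le_exp_sum_sq S₀ D c n hσ).trans (Real.exp_le_exp.mpr (neg_le_neg ?_))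
  have hn' : (0:ℝ) < n := Nat.cast_pos.mpr (Nat.pos_of_ne_zero hn)
  have htel : ∑ k ∈ range n, (c (k + 1) - c k) = c n - c 0 := sum_range_sub c n
  have hcs := sq_sum_le_mul_sum_sq n (fun k => c (k + 1) - c k)
  rw [htel] at hcs
  rw [mul_div_assoc]
  refine mul_le_mul_of_nonneg_left ?_ (sq_nonneg _)
  rw [div_le_iff₀ hn']
  linarith

/-- **UNIFORM GRID: `ÊSS_perfect ≤ exp(−σ_min²/n)`** (`c_k = k/n`, `n ≠ 0`, variance floor). -/
theorem essFrac_path_perfect_uniform_le (S₀ D : X → ℝ) {n : ℕ} (hn : n ≠ 0) {σmin : ℝ}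
    (hσ : ∀ c, σmin ^ 2 ≤ varD S₀ D c) :
    essFrac (revPathLaw (fun k : Fin (n + 1) => linAction S₀ D ((k : ℝ) / n))
          (fun k : Fin n => fun (_ : X) (y : X) => gibbsLaw (linAction S₀ D ((((k : ℕ) + 1 : ℕ) : ℝ) / n)) y))
        (pathLaw (gibbsLaw (linAction S₀ D ((((0 : Fin (n + 1)) : ℕ) : ℝ) / n)))
          (fun k : Fin n => fun (_ : X) (y : X) =>
            gibbsLaw (linAction S₀ D ((((k : ℕ) + 1 : ℕ) : ℝ) / n)) y))
      ≤ Real.exp (-(σmin ^ 2 / n)) := by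
  have hn' : (n:ℝ) ≠ 0 := Nat.cast_ne_zero.mpr hn
  have h := essFrac_path_perfect_le_exp_span S₀ D (fun k : ℕ => (k : ℝ) / n) hn hσ
  simp only [Nat.cast_zero, zero_div, sub_zero, div_self hn', one_pow, mul_one] at h
  simp only [Nat.cast_add, Nat.cast_one] at h ⊢
  exact h

/-- **THE TWO-SIDED WINDOW OF THE PERFECT PART (uniform grid)**: with a floor AND a ceiling on
the variance, `σ_min² ≤ Var_c(D) ≤ σ̄²` for every `c`,
`exp(−σ̄²/n) ≤ ÊSS_perfect ≤ exp(−σ_min²/n)`. -/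
theorem essFrac_path_perfect_uniform_two_sided (S₀ D : X → ℝ) {n : ℕ} (hn : n ≠ 0)
    {σmin σbar : ℝ} (hσmin : ∀ c, σmin ^ 2 ≤ varD S₀ D c) (hσbar : ∀ c, varD S₀ D c ≤ σbar ^ 2) :
    Real.exp (-(σbar ^ 2 / n))
      ≤ essFrac (revPathLaw (fun k : Fin (n + 1) => linAction S₀ D ((k : ℝ) / n))
          (fun k : Fin n => fun (_ : X) (y : X) => gibbsLaw (linAction S₀ D ((((k : ℕ) + 1 : ℕ) : ℝ) / n)) y))
        (pathLaw (gibbsLaw (linAction S₀ D ((((0 : Fin (n + 1)) : ℕ) : ℝ) / n)))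
          (fun k : Fin n => fun (_ : X) (y : X) =>
            gibbsLaw (linAction S₀ D ((((k : ℕ) + 1 : ℕ) : ℝ) / n)) y))
    ∧ essFrac (revPathLaw (fun k : Fin (n + 1) => linAction S₀ D ((k : ℝ) / n))
          (fun k : Fin n => fun (_ : X) (y : X) => gibbsLaw (linAction S₀ D ((((k : ℕ) + 1 : ℕ) : ℝ) / n)) y))
        (pathLaw (gibbsLaw (linAction S₀ D ((((0 : Fin (n + 1)) : ℕ) : ℝ) / n)))
          (fun k : Fin n => fun (_ : X) (y : X) =>
            gibbsLaw (linAction S₀ D ((((k : ℕ) + 1 : ℕ) : ℝ) / n)) y))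
      ≤ Real.exp (-(σmin ^ 2 / n)) :=
  ⟨essFrac_path_perfect_uniform_ge S₀ D hn hσbar, essFrac_path_perfect_uniform_le S₀ D hn hσmin⟩

/-- **THE NECESSARY STEP COUNT**: if the perfectly relaxed protocol along a grid of `n ≠ 0` steps
from `c_0` to `c_n` reaches `e^{−η} ≤ ÊSS_perfect`, then `σ_min²(c_n − c_0)² ≤ η·n`. -/
theorem steps_ge_of_essFrac_path_perfect_ge (S₀ D : X → ℝ) (c : ℕ → ℝ) {n : ℕ} (hn : n ≠ 0)
    {σmin η : ℝ} (hσ : ∀ c', σmin ^ 2 ≤ varD S₀ D c')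
    (hess : Real.exp (-η)
      ≤ essFrac (revPathLaw (fun k : Fin (n + 1) => linAction S₀ D (c k))
          (fun k : Fin n => fun (_ : X) (y : X) => gibbsLaw (linAction S₀ D (c ((k : ℕ) + 1))) y))
        (pathLaw (gibbsLaw (linAction S₀ D (c ((0 : Fin (n + 1)) : ℕ))))
          (fun k : Fin n => fun (_ : X) (y : X) =>
            gibbsLaw (linAction S₀ D (c ((k : ℕ) + 1))) y))) :
    σmin ^ 2 * (c n - c 0) ^ 2 ≤ η * n := by
  have hn' : (0:ℝ) < n := Nat.cast_pos.mpr (Nat.pos_of_ne_zero hn)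
  have h := hess.trans (essFrac_path_perfect_le_exp_span S₀ D c hn hσ)
  have h' := Real.exp_le_exp.mp h
  have h'' : σmin ^ 2 * (c n - c 0) ^ 2 / n ≤ η := by linarith
  rwa [div_le_iff₀ hn'] at h''

end Summit.Ventures.LatticeQCDFlow.Scaling
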